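import Mathlib.Analysis.InnerProductSpace.Basic
import Literature.MathematicalPhysics.QuantumFieldTheory.Balaban1983to89.B4Eq19LatticeOperators
import HarnessLib

/-!
# F3′ «MAXIMAL-FUNCTION GOOD SHELL»: a radius whose shells carry their fair share of energy AT EVERY THICKNESS AT ONCE, with an ABSOLUTE constant

SEAT ym3-torus-px7 g5 (helper for `stmt-QuantumFields-19936`; LEAD ym-ust-19936-w1 g9 06:41:10Z g9-6 (ii) `hLogFreeDecay`, px7 second chair of the LOG-FREE F5 LOCATE;
bus 06:44Z finding: the E→R chain's only log source is the `(k+1)²` of px8's ✓`PoincareLipschitzMultiScaleGoodShell.exists_goodRadius` — a Chebyshev union bound).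
THIS FILE replaces the union bound by the discrete one-sided Hardy–Littlewood maximal inequality in F. Riesz's RISING-SUN form: for nonneg weights `f` on `ℤ`,
`λ·#{s ∈ [p,q] : ∃ 1 ≤ t ≤ N, Σ_{j∈(s,s+t]} f j > λt} ≤ Σ_{j∈(p,q+N]} f j` (scan from the left: the first bad `s₀` with witness `t₀` accounts for at most `t₀ < λ⁻¹Σ_{(s₀,s₀+t₀]}f`
bad points; induct on the window) and its mirror; hence in a window of `#T = q − p + 1` radii some `r′` has BOTH `Σ_{B(r′)∖B(r′−t)} c ≤ λt` and `Σ_{B(r′+t)∖B(r′)} c ≤ λt` for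
ALL `1 ≤ t ≤ N`, `λ = 4·(Σ_{B(q+N)} c)∕#T` — no `k²`, no logarithm.  Letters = px8's `exists_goodRadius_family`: a monotone family `B : ℤ → Finset α` (e.g. `box z`), site
weights `c ≥ 0`; def-free (the bad sets are written as `Finset.filter`s in place).

WHAT IS PROVED (ns `…Theorems.PoincareLipschitzMaximalGoodShell`): §1 `rising_sun_right`, `rising_sun_left` (the two one-sided maximal inequalities, counting form);
§2 `sum_sdiff_eq_sum_shells` (band = sum of unit shells for a monotone family); §3 ★★ `exists_goodRadius_maximal` (generic), ★★ `exists_goodRadius_maximal_box` (`B = box z`),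
★★ `exists_goodRadius_dyadic_logfree` (px8's dyadic depth bands with `(k+1)² ↦ 4∕3`).
HONEST SCOPE.  [folklore] ([Garling2007] «Inequalities» §8 (F. Riesz's rising sun lemma, the maximal inequality) pp.124–127; [Grafakos2014] §2.1).  A brick for the log-free
one-step; proves nothing of `hImprove`∕`hRegH`∕`stmt-QuantumFields-19936`; YM₃ on T³ is rung R3, not Clay.
-/

set_option autoImplicit false

noncomputable section

open scoped BigOperators
open Finset

namespace Summit.QuantumFields.YangMills.Theorems.PoincareLipschitzMaximalGoodShell

open Literature.MathematicalPhysics.QuantumFieldTheory.Balaban1983to89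
open B4Eq19LatticeOperators

/-! ## §1 The rising-sun maximal inequalities on `ℤ` -/

/-- **RISING SUN, RIGHT-SIDED.**  `f ≥ 0` on `ℤ`, `λ > 0`, `N ≥ 0`: `λ · #{s ∈ [p,q] : ∃ t ∈ [1,N], λt < Σ_{j∈[s,s+t)} f j} ≤ Σ_{j∈[p,q+N)} f j`.
[folklore] [cite: Garling2007, §8 pp.124-127] -/
theorem rising_sun_right (f : ℤ → ℝ) (hf : ∀ j, 0 ≤ f j) {lam : ℝ} (hlam : 0 < lam) (N p q : ℤ) :
    lam * (((Icc p q).filter (fun s => ∃ t ∈ Icc (1 : ℤ) N, lam * t < ∑ j ∈ Ioc s (s + t), f j)).card : ℝ) ≤ ∑ j ∈ Ioc p (q + N), f j := by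
  classical
  -- induction on the window length, generalising the left end
  suffices h : ∀ n : ℕ, ∀ p : ℤ, (q + 1 - p).toNat ≤ n →
      lam * (((Icc p q).filter (fun s => ∃ t ∈ Icc (1 : ℤ) N, lam * t < ∑ j ∈ Ioc s (s + t), f j)).card : ℝ) ≤ ∑ j ∈ Ioc p (q + N), f j from
    h _ p le_rfl
  intro n
  induction n with
  | zero =>
    intro p hp
    have hqp : q < p := by
      have : q + 1 - p ≤ 0 := by
        rcases le_or_gt (q + 1 - p) 0 with h | h
        · exact h
        · have := Int.toNat_of_nonneg h.le; omega
      linarith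
    rw [Finset.Icc_eq_empty (not_le.2 hqp), Finset.filter_empty, Finset.card_empty, Nat.cast_zero, mul_zero]
    exact Finset.sum_nonneg fun j _ => hf j
  | succ n ih =>
    intro p hp
    set bad := (Icc p q).filter (fun s => ∃ t ∈ Icc (1 : ℤ) N, lam * t < ∑ j ∈ Ioc s (s + t), f j) with hbad
    have hsum0 : 0 ≤ ∑ j ∈ Ioc p (q + N), f j := Finset.sum_nonneg fun j _ => hf j
    by_cases hne : bad.Nonempty
    · -- the first bad point and its witness
      set s₀ := bad.min' hne with hs₀
      have hs₀mem : s₀ ∈ bad := Finset.min'_mem bad hne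
      have hs₀min : ∀ s ∈ bad, s₀ ≤ s := fun s hs => Finset.min'_le bad s hs
      rw [hbad, Finset.mem_filter, Finset.mem_Icc] at hs₀mem
      obtain ⟨⟨hps₀, hs₀q⟩, t₀, ht₀, hwit⟩ := hs₀mem
      rw [Finset.mem_Icc] at ht₀
      -- split the bad set at `s₀ + t₀`
      set p' := s₀ + t₀ with hp'
      set bad' := (Icc p' q).filter (fun s => ∃ t ∈ Icc (1 : ℤ) N, lam * t < ∑ j ∈ Ioc s (s + t), f j) with hbad'
      have hsplit : bad ⊆ Icc s₀ (p' - 1) ∪ bad' := by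
        intro s hs
        have hs' := hs
        rw [hbad, Finset.mem_filter, Finset.mem_Icc] at hs'
        rw [Finset.mem_union, Finset.mem_Icc, hbad', Finset.mem_filter, Finset.mem_Icc]
        by_cases hlt : s < p'
        · exact Or.inl ⟨hs₀min s hs, by omega⟩
        · exact Or.inr ⟨⟨not_lt.1 hlt, hs'.1.2⟩, hs'.2⟩
      have hcard : (bad.card : ℝ) ≤ (t₀ : ℝ) + (bad'.card : ℝ) := by
        have h1 : bad.card ≤ (Icc s₀ (p' - 1)).card + bad'.card := (Finset.card_le_card hsplit).trans (Finset.card_union_le _ _)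
        have h2 : ((Icc s₀ (p' - 1)).card : ℝ) = t₀ := by
          rw [Int.card_Icc]
          have : p' - 1 + 1 - s₀ = t₀ := by omega
          rw [this]
          have e : ((t₀.toNat : ℕ) : ℝ) = ((t₀.toNat : ℤ) : ℝ) := (Int.cast_natCast _).symm
          rw [e, Int.toNat_of_nonneg (by omega)]
        calc (bad.card : ℝ) ≤ ((Icc s₀ (p' - 1)).card : ℝ) + (bad'.card : ℝ) := by exact_mod_cast h1
          _ = (t₀ : ℝ) + (bad'.card : ℝ) := by rw [h2]
      -- the induction hypothesis on the window `[p', q]`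
      have hih : lam * (bad'.card : ℝ) ≤ ∑ j ∈ Ioc p' (q + N), f j := ih p' (by
        have : (q + 1 - p).toNat ≤ n + 1 := hp
        have h1 : q + 1 - p' ≤ q + 1 - p - 1 := by omega
        by_cases hnn : 0 ≤ q + 1 - p'
        · have e1 := Int.toNat_of_nonneg hnn
          have e2 := Int.toNat_of_nonneg (show 0 ≤ q + 1 - p by omega)
          omega
        · rw [Int.toNat_eq_zero.2 (by omega)]; omega)
      -- assemble
      have hwit' : lam * (t₀ : ℝ) < ∑ j ∈ Ioc s₀ p', f j := hwit
      have hunion : ∑ j ∈ Ioc s₀ p', f j + ∑ j ∈ Ioc p' (q + N), f j = ∑ j ∈ Ioc s₀ (q + N), f j := by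
        rw [← Finset.sum_union (Finset.Ioc_disjoint_Ioc_of_le le_rfl), Finset.Ioc_union_Ioc_eq_Ioc (by omega) (by omega)]
      have hmono : ∑ j ∈ Ioc s₀ (q + N), f j ≤ ∑ j ∈ Ioc p (q + N), f j :=
        Finset.sum_le_sum_of_subset_of_nonneg (Finset.Ioc_subset_Ioc hps₀ le_rfl) fun j _ _ => hf j
      calc lam * (bad.card : ℝ) ≤ lam * ((t₀ : ℝ) + (bad'.card : ℝ)) := mul_le_mul_of_nonneg_left hcard hlam.le
        _ = lam * (t₀ : ℝ) + lam * (bad'.card : ℝ) := by ring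
        _ ≤ ∑ j ∈ Ioc s₀ p', f j + ∑ j ∈ Ioc p' (q + N), f j := add_le_add hwit'.le hih
        _ = ∑ j ∈ Ioc s₀ (q + N), f j := hunion
        _ ≤ ∑ j ∈ Ioc p (q + N), f j := hmono
    · rw [Finset.not_nonempty_iff_eq_empty.1 hne, Finset.card_empty, Nat.cast_zero, mul_zero]
      exact hsum0

/-- **RISING SUN, LEFT-SIDED** (the mirror image): `λ · #{s ∈ [p,q] : ∃ t ∈ [1,N], λt < Σ_{j∈(s−t,s]} f j} ≤ Σ_{j∈(p−N,q]} f j`. [folklore] [cite: Garling2007, §8 pp.124-127] -/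
theorem rising_sun_left (f : ℤ → ℝ) (hf : ∀ j, 0 ≤ f j) {lam : ℝ} (hlam : 0 < lam) (N p q : ℤ) :
    lam * (((Icc p q).filter (fun s => ∃ t ∈ Icc (1 : ℤ) N, lam * t < ∑ j ∈ Ioc (s - t) s, f j)).card : ℝ) ≤ ∑ j ∈ Ioc (p - N) q, f j := by
  classical
  suffices h : ∀ n : ℕ, ∀ q : ℤ, (q + 1 - p).toNat ≤ n →
      lam * (((Icc p q).filter (fun s => ∃ t ∈ Icc (1 : ℤ) N, lam * t < ∑ j ∈ Ioc (s - t) s, f j)).card : ℝ) ≤ ∑ j ∈ Ioc (p - N) q, f j from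
    h _ q le_rfl
  intro n
  induction n with
  | zero =>
    intro q hq
    have hqp : q < p := by
      have : q + 1 - p ≤ 0 := by
        rcases le_or_gt (q + 1 - p) 0 with h | h
        · exact h
        · have := Int.toNat_of_nonneg h.le; omega
      linarith
    rw [Finset.Icc_eq_empty (not_le.2 hqp), Finset.filter_empty, Finset.card_empty, Nat.cast_zero, mul_zero]
    exact Finset.sum_nonneg fun j _ => hf j
  | succ n ih =>
    intro q hq
    set bad := (Icc p q).filter (fun s => ∃ t ∈ Icc (1 : ℤ) N, lam * t < ∑ j ∈ Ioc (s - t) s, f j) with hbad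
    have hsum0 : 0 ≤ ∑ j ∈ Ioc (p - N) q, f j := Finset.sum_nonneg fun j _ => hf j
    by_cases hne : bad.Nonempty
    · set s₀ := bad.max' hne with hs₀
      have hs₀mem : s₀ ∈ bad := Finset.max'_mem bad hne
      have hs₀max : ∀ s ∈ bad, s ≤ s₀ := fun s hs => Finset.le_max' bad s hs
      rw [hbad, Finset.mem_filter, Finset.mem_Icc] at hs₀mem
      obtain ⟨⟨hps₀, hs₀q⟩, t₀, ht₀, hwit⟩ := hs₀mem
      rw [Finset.mem_Icc] at ht₀
      set q' := s₀ - t₀ with hq'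
      set bad' := (Icc p q').filter (fun s => ∃ t ∈ Icc (1 : ℤ) N, lam * t < ∑ j ∈ Ioc (s - t) s, f j) with hbad'
      have hsplit : bad ⊆ Icc (q' + 1) s₀ ∪ bad' := by
        intro s hs
        have hs' := hs
        rw [hbad, Finset.mem_filter, Finset.mem_Icc] at hs'
        rw [Finset.mem_union, Finset.mem_Icc, hbad', Finset.mem_filter, Finset.mem_Icc]
        by_cases hlt : q' < s
        · exact Or.inl ⟨by omega, hs₀max s hs⟩
        · exact Or.inr ⟨⟨hs'.1.1, not_lt.1 hlt⟩, hs'.2⟩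
      have hcard : (bad.card : ℝ) ≤ (t₀ : ℝ) + (bad'.card : ℝ) := by
        have h1 : bad.card ≤ (Icc (q' + 1) s₀).card + bad'.card := (Finset.card_le_card hsplit).trans (Finset.card_union_le _ _)
        have h2 : ((Icc (q' + 1) s₀).card : ℝ) = t₀ := by
          rw [Int.card_Icc]
          have : s₀ + 1 - (q' + 1) = t₀ := by omega
          rw [this]
          have e : ((t₀.toNat : ℕ) : ℝ) = ((t₀.toNat : ℤ) : ℝ) := (Int.cast_natCast _).symm
          rw [e, Int.toNat_of_nonneg (by omega)]
        calc (bad.card : ℝ) ≤ ((Icc (q' + 1) s₀).card : ℝ) + (bad'.card : ℝ) := by exact_mod_cast h1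
          _ = (t₀ : ℝ) + (bad'.card : ℝ) := by rw [h2]
      have hih : lam * (bad'.card : ℝ) ≤ ∑ j ∈ Ioc (p - N) q', f j := ih q' (by
        have : (q + 1 - p).toNat ≤ n + 1 := hq
        by_cases hnn : 0 ≤ q' + 1 - p
        · have e1 := Int.toNat_of_nonneg hnn
          have e2 := Int.toNat_of_nonneg (show 0 ≤ q + 1 - p by omega)
          omega
        · rw [Int.toNat_eq_zero.2 (by omega)]; omega)
      have hwit' : lam * (t₀ : ℝ) < ∑ j ∈ Ioc q' s₀, f j := hwit
      have hunion : ∑ j ∈ Ioc (p - N) q', f j + ∑ j ∈ Ioc q' s₀, f j = ∑ j ∈ Ioc (p - N) s₀, f j := by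
        rw [← Finset.sum_union (Finset.Ioc_disjoint_Ioc_of_le le_rfl), Finset.Ioc_union_Ioc_eq_Ioc (by omega) (by omega)]
      have hmono : ∑ j ∈ Ioc (p - N) s₀, f j ≤ ∑ j ∈ Ioc (p - N) q, f j :=
        Finset.sum_le_sum_of_subset_of_nonneg (Finset.Ioc_subset_Ioc le_rfl hs₀q) fun j _ _ => hf j
      calc lam * (bad.card : ℝ) ≤ lam * ((t₀ : ℝ) + (bad'.card : ℝ)) := mul_le_mul_of_nonneg_left hcard hlam.le
        _ = lam * (bad'.card : ℝ) + lam * (t₀ : ℝ) := by ring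
        _ ≤ ∑ j ∈ Ioc (p - N) q', f j + ∑ j ∈ Ioc q' s₀, f j := add_le_add hih hwit'.le
        _ = ∑ j ∈ Ioc (p - N) s₀, f j := hunion
        _ ≤ ∑ j ∈ Ioc (p - N) q, f j := hmono
    · rw [Finset.not_nonempty_iff_eq_empty.1 hne, Finset.card_empty, Nat.cast_zero, mul_zero]
      exact hsum0


/-! ## §2 Bands of a monotone family are sums of unit shells -/

/-- For a monotone family `B : ℤ → Finset α` and `u ≤ v`: `Σ_{y ∈ B v ∖ B u} c y = Σ_{s ∈ (u,v]} Σ_{y ∈ B s ∖ B(s−1)} c y`. [folklore] -/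
theorem sum_sdiff_eq_sum_shells {α : Type*} [DecidableEq α] (B : ℤ → Finset α) (hB : Monotone B) (c : α → ℝ) {u v : ℤ} (huv : u ≤ v) :
    ∑ y ∈ B v \ B u, c y = ∑ s ∈ Ioc u v, ∑ y ∈ B s \ B (s - 1), c y := by
  suffices h : ∀ n : ℕ, ∀ v : ℤ, u ≤ v → (v - u).toNat = n → ∑ y ∈ B v \ B u, c y = ∑ s ∈ Ioc u v, ∑ y ∈ B s \ B (s - 1), c y from
    h _ v huv rfl
  intro n
  induction n with
  | zero =>
    intro v huv hn
    have hv : v = u := by have := Int.toNat_of_nonneg (show 0 ≤ v - u by omega); omega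
    subst hv
    rw [Finset.sdiff_self, Finset.Ioc_self, Finset.sum_empty, Finset.sum_empty]
  | succ n ih =>
    intro v huv hn
    have huv' : u ≤ v - 1 := by
      have := Int.toNat_of_nonneg (show 0 ≤ v - u by omega); omega
    have h1 := ih (v - 1) huv' (by have := Int.toNat_of_nonneg (show 0 ≤ v - u by omega); have := Int.toNat_of_nonneg (show 0 ≤ v - 1 - u by omega); omega)
    -- `B v ∖ B u = (B v ∖ B(v−1)) ⊔ (B(v−1) ∖ B u)`
    have hsplit : B v \ B u = (B v \ B (v - 1)) ∪ (B (v - 1) \ B u) := by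
      ext y
      simp only [Finset.mem_sdiff, Finset.mem_union]
      constructor
      · rintro ⟨hyv, hyu⟩
        by_cases hy1 : y ∈ B (v - 1)
        · exact Or.inr ⟨hy1, hyu⟩
        · exact Or.inl ⟨hyv, hy1⟩
      · rintro (⟨hyv, hy1⟩ | ⟨hy1, hyu⟩)
        · exact ⟨hyv, fun hyu => hy1 (hB huv' hyu)⟩
        · exact ⟨hB (by omega) hy1, hyu⟩
    have hdisj : Disjoint (B v \ B (v - 1)) (B (v - 1) \ B u) := by
      rw [Finset.disjoint_left]
      intro y hy hy'
      rw [Finset.mem_sdiff] at hy hy'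
      exact hy.2 hy'.1
    have hIoc : Ioc u v = Ioc u (v - 1) ∪ Ioc (v - 1) v := (Finset.Ioc_union_Ioc_eq_Ioc huv' (by omega)).symm
    have hIoc1 : Ioc (v - 1) v = {v} := by
      ext s; simp only [Finset.mem_Ioc, Finset.mem_singleton]; omega
    rw [hsplit, Finset.sum_union hdisj, hIoc, Finset.sum_union (Finset.Ioc_disjoint_Ioc_of_le le_rfl), hIoc1, Finset.sum_singleton, h1, add_comm]

/-! ## §3 ★★ The good radius -/

/-- ★★ **MAXIMAL-FUNCTION GOOD RADIUS** (generic): `B : ℤ → Finset α` monotone, site weights `c ≥ 0`, a window of radii `[p,q]` (`p ≤ q`) and a horizon `N ≥ 1`.  Some `r′ ∈ [p,q]`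
has, for EVERY thickness `1 ≤ t ≤ N` at once, inner band `Σ_{B(r′) ∖ B(r′−t)} c ≤ λt` and outer band `Σ_{B(r′+t) ∖ B(r′)} c ≤ λt`, `λ = 4·(Σ_{B(q+N)} c)∕(q − p + 1)` — an ABSOLUTE
constant (no `log`, no `k²`): the two rising-sun inequalities leave fewer than `#[p,q]` bad radii. [folklore] [cite: Garling2007, §8 pp.124-127; Grafakos2014, Thm 2.1.6] -/
theorem exists_goodRadius_maximal {α : Type*} [DecidableEq α] (B : ℤ → Finset α) (hB : Monotone B) (c : α → ℝ) (hc : ∀ y, 0 ≤ c y)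
    {p q N : ℤ} (hpq : p ≤ q) (hN : 1 ≤ N) :
    ∃ r' ∈ Icc p q, ∀ t ∈ Icc (1 : ℤ) N,
      ∑ y ∈ B r' \ B (r' - t), c y ≤ 4 * (∑ y ∈ B (q + N), c y) / ((q : ℝ) - p + 1) * t ∧
      ∑ y ∈ B (r' + t) \ B r', c y ≤ 4 * (∑ y ∈ B (q + N), c y) / ((q : ℝ) - p + 1) * t := by
  classical
  set M : ℝ := ∑ y ∈ B (q + N), c y with hM
  set L : ℝ := (q : ℝ) - p + 1 with hL
  have hpqR : (p : ℝ) ≤ q := by exact_mod_cast hpq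
  have hL0 : 0 < L := by rw [hL]; linarith
  have hM0 : 0 ≤ M := Finset.sum_nonneg fun y _ => hc y
  -- the shell weights
  set f : ℤ → ℝ := fun s => ∑ y ∈ B s \ B (s - 1), c y with hf
  have hf0 : ∀ s, 0 ≤ f s := fun s => Finset.sum_nonneg fun y _ => hc y
  -- band sums as shell sums, and their sizes
  have hband : ∀ u v : ℤ, u ≤ v → ∑ y ∈ B v \ B u, c y = ∑ s ∈ Ioc u v, f s := fun u v huv => sum_sdiff_eq_sum_shells B hB c huv
  have hbandM : ∀ u v : ℤ, u ≤ v → v ≤ q + N → ∑ s ∈ Ioc u v, f s ≤ M := by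
    intro u v huv hv
    rw [← hband u v huv, hM]
    exact Finset.sum_le_sum_of_subset_of_nonneg (Finset.sdiff_subset.trans (hB hv)) fun y _ _ => hc y
  by_cases hMz : M = 0
  · -- all weights vanish below `B(q+N)`: every band is `0`
    refine ⟨p, Finset.mem_Icc.2 ⟨le_rfl, hpq⟩, fun t ht => ?_⟩
    rw [Finset.mem_Icc] at ht
    have h1 : ∑ y ∈ B p \ B (p - t), c y ≤ 0 := by
      rw [hband _ _ (by omega)]; exact (hbandM _ _ (by omega) (by omega)).trans hMz.le
    have h2 : ∑ y ∈ B (p + t) \ B p, c y ≤ 0 := by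
      rw [hband _ _ (by omega)]; exact (hbandM _ _ (by omega) (by omega)).trans hMz.le
    rw [hMz]; simp only [mul_zero, zero_div, zero_mul]
    exact ⟨h1, h2⟩
  · have hMpos : 0 < M := lt_of_le_of_ne hM0 (Ne.symm hMz)
    set lam : ℝ := 4 * M / L with hlam
    have hlam0 : 0 < lam := by rw [hlam]; positivity
    -- the two bad sets
    set badR := (Icc p q).filter (fun s => ∃ t ∈ Icc (1 : ℤ) N, lam * t < ∑ j ∈ Ioc s (s + t), f j) with hbadR
    set badL := (Icc p q).filter (fun s => ∃ t ∈ Icc (1 : ℤ) N, lam * t < ∑ j ∈ Ioc (s - t) s, f j) with hbadL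
    have hR := rising_sun_right f hf0 hlam0 N p q
    have hLft := rising_sun_left f hf0 hlam0 N p q
    have hR' : lam * (badR.card : ℝ) ≤ M := hR.trans (hbandM _ _ (by omega) le_rfl)
    have hL' : lam * (badL.card : ℝ) ≤ M := by
      refine hLft.trans ?_
      rw [← hband _ _ (by omega), hM]
      exact Finset.sum_le_sum_of_subset_of_nonneg (Finset.sdiff_subset.trans (hB (by omega))) fun y _ _ => hc y
    -- fewer than `#[p,q]` bad radii
    have hcardT : ((Icc p q).card : ℝ) = L := by
      rw [Int.card_Icc, hL]
      have e : (((q + 1 - p).toNat : ℕ) : ℝ) = (((q + 1 - p).toNat : ℤ) : ℝ) := (Int.cast_natCast _).symm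
      rw [e, Int.toNat_of_nonneg (by omega)]; push_cast; ring
    have hfew : ((badR ∪ badL).card : ℝ) < ((Icc p q).card : ℝ) := by
      have h1 : ((badR ∪ badL).card : ℝ) ≤ (badR.card : ℝ) + (badL.card : ℝ) := by exact_mod_cast Finset.card_union_le _ _
      have h2 : lam * ((badR.card : ℝ) + (badL.card : ℝ)) ≤ 2 * M := by rw [mul_add]; linarith
      have h3 : (badR.card : ℝ) + (badL.card : ℝ) ≤ L / 2 := by
        have h4 : M * (4 * ((badR.card : ℝ) + (badL.card : ℝ))) ≤ M * (2 * L) := by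
          have := h2
          rw [hlam, div_mul_eq_mul_div, div_le_iff₀ hL0] at this
          linarith
        have h5 : 4 * ((badR.card : ℝ) + (badL.card : ℝ)) ≤ 2 * L := le_of_mul_le_mul_left h4 hMpos
        linarith
      rw [hcardT]; linarith
    have hnot : ¬ (Icc p q ⊆ badR ∪ badL) := by
      intro hcon
      have h1 := Finset.card_le_card hcon
      have : ((Icc p q).card : ℝ) ≤ ((badR ∪ badL).card : ℝ) := by exact_mod_cast h1
      linarith
    obtain ⟨r', hr'T, hr'good⟩ := Finset.not_subset.1 hnot
    refine ⟨r', hr'T, fun t ht => ?_⟩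
    have hgR : ¬ (lam * (t : ℝ) < ∑ j ∈ Ioc r' (r' + t), f j) := fun h =>
      hr'good (Finset.mem_union.2 (Or.inl (by rw [hbadR, Finset.mem_filter]; exact ⟨hr'T, t, ht, h⟩)))
    have hgL : ¬ (lam * (t : ℝ) < ∑ j ∈ Ioc (r' - t) r', f j) := fun h =>
      hr'good (Finset.mem_union.2 (Or.inr (by rw [hbadL, Finset.mem_filter]; exact ⟨hr'T, t, ht, h⟩)))
    have ht' := ht
    rw [Finset.mem_Icc] at ht'
    have e : 4 * M / L * (t : ℝ) = lam * t := by rw [hlam]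
    refine ⟨?_, ?_⟩
    · rw [hband _ _ (by omega), e]; exact not_lt.1 hgL
    · rw [hband _ _ (by omega), e]; exact not_lt.1 hgR

/-- ★★ **MAXIMAL-FUNCTION GOOD RADIUS ON `ℤ^d` BOXES**: the instance `B = box z` (lit ✓`B4Eq19LatticeOperators.box`) — some `r′ ∈ [p,q]` with
`Σ_{Q_{r′}(z) ∖ Q_{r′−t}(z)} c ≤ λt` and `Σ_{Q_{r′+t}(z) ∖ Q_{r′}(z)} c ≤ λt` for all `1 ≤ t ≤ N`, `λ = 4·(Σ_{Q_{q+N}(z)} c)∕(q − p + 1)`: the log-free replacement of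
✓`PoincareLipschitzMultiScaleGoodShell.exists_goodRadius`'s `(k+1)²`-weighted bands. [folklore] [cite: Garling2007, §8 pp.124-127; SchoenUhlenbeck1982, §4] -/
theorem exists_goodRadius_maximal_box {d : ℕ} (z : Zd d) (c : Zd d → ℝ) (hc : ∀ y, 0 ≤ c y) {p q N : ℤ} (hpq : p ≤ q) (hN : 1 ≤ N) :
    ∃ r' ∈ Icc p q, ∀ t ∈ Icc (1 : ℤ) N,
      ∑ y ∈ box z r' \ box z (r' - t), c y ≤ 4 * (∑ y ∈ box z (q + N), c y) / ((q : ℝ) - p + 1) * t ∧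
      ∑ y ∈ box z (r' + t) \ box z r', c y ≤ 4 * (∑ y ∈ box z (q + N), c y) / ((q : ℝ) - p + 1) * t :=
  exists_goodRadius_maximal (box z) (fun _ _ h => box_mono z h) c hc hpq hN


/-- ★★ **THE LOG-FREE DYADIC DEPTH BANDS** — px8's ✓`PoincareLipschitzMultiScaleGoodShell.exists_goodRadius_dyadic` conclusion with its `(k+1)²` replaced by the ABSOLUTE
`4∕3`, under the room hypothesis `q + 2^{n+1} ≤ r` (the bands of thickness `≤ 2^{n+1}` stay inside `Q_r(z)`): some `r′ ∈ [p,q]` has, for every `k < n`,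
`(q − p + 1)·Σ_{Q_{r′−2^k}(z) ∖ Q_{r′−2^{k+2}}(z)} c ≤ 4·(4∕3)·(3·2^k·Σ_{Q_r(z)} c)`.  (`exists_goodRadius_maximal_box` at `N = 2^{n+1}`, inner band of thickness `2^{k+2}`.)
[folklore] [cite: Garling2007, §8 pp.124-127; SchoenUhlenbeck1982, §4] -/
theorem exists_goodRadius_dyadic_logfree {d : ℕ} (z : Zd d) (r : ℤ) {p q : ℤ} (hpq : p ≤ q) (n : ℕ) (hq : q + (2 : ℤ) ^ (n + 1) ≤ r)
    (c : Zd d → ℝ) (hc : ∀ y, 0 ≤ c y) :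
    ∃ r' ∈ Finset.Icc p q, ∀ k < n,
      ((q - p + 1 : ℤ) : ℝ) * ∑ y ∈ box z (r' - (2 : ℤ) ^ k) \ box z (r' - (2 : ℤ) ^ (k + 2)), c y
        ≤ 4 * (4 / 3 : ℝ) * ((3 * (2 : ℝ) ^ k) * ∑ y ∈ box z r, c y) := by
  have hN : (1 : ℤ) ≤ (2 : ℤ) ^ (n + 1) := one_le_pow₀ (by norm_num)
  obtain ⟨r', hr', hgood⟩ := exists_goodRadius_maximal_box z c hc hpq hN
  refine ⟨r', hr', fun k hk => ?_⟩
  have hr'q : r' ≤ q := (Finset.mem_Icc.1 hr').2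
  -- the band of thickness `2^{k+2} ≤ 2^{n+1}`
  have ht : (2 : ℤ) ^ (k + 2) ∈ Icc (1 : ℤ) ((2 : ℤ) ^ (n + 1)) :=
    Finset.mem_Icc.2 ⟨one_le_pow₀ (by norm_num), pow_le_pow_right₀ (by norm_num) (by omega)⟩
  have hin := (hgood _ ht).1
  have h2k : (0 : ℤ) ≤ (2 : ℤ) ^ k := pow_nonneg (by norm_num) k
  have hsub : box z (r' - (2 : ℤ) ^ k) \ box z (r' - (2 : ℤ) ^ (k + 2)) ⊆ box z r' \ box z (r' - (2 : ℤ) ^ (k + 2)) :=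
    Finset.sdiff_subset_sdiff (box_mono z (by linarith)) le_rfl
  have hband : ∑ y ∈ box z (r' - (2 : ℤ) ^ k) \ box z (r' - (2 : ℤ) ^ (k + 2)), c y ≤
      4 * (∑ y ∈ box z (q + (2 : ℤ) ^ (n + 1)), c y) / ((q : ℝ) - p + 1) * (((2 : ℤ) ^ (k + 2) : ℤ) : ℝ) :=
    (Finset.sum_le_sum_of_subset_of_nonneg hsub fun y _ _ => hc y).trans hin
  have hM : ∑ y ∈ box z (q + (2 : ℤ) ^ (n + 1)), c y ≤ ∑ y ∈ box z r, c y :=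
    Finset.sum_le_sum_of_subset_of_nonneg (box_mono z hq) fun y _ _ => hc y
  have hM0 : 0 ≤ ∑ y ∈ box z r, c y := Finset.sum_nonneg fun y _ => hc y
  have hpqR : (p : ℝ) ≤ q := by exact_mod_cast hpq
  have hL : (0 : ℝ) < (q : ℝ) - p + 1 := by linarith
  have eL : (((q - p + 1 : ℤ)) : ℝ) = (q : ℝ) - p + 1 := by push_cast; ring
  have e2 : ((((2 : ℤ) ^ (k + 2) : ℤ)) : ℝ) = 4 * (2 : ℝ) ^ k := by push_cast; ring
  rw [eL]
  rw [e2] at hband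
  calc ((q : ℝ) - p + 1) * ∑ y ∈ box z (r' - (2 : ℤ) ^ k) \ box z (r' - (2 : ℤ) ^ (k + 2)), c y
      ≤ ((q : ℝ) - p + 1) * (4 * (∑ y ∈ box z (q + (2 : ℤ) ^ (n + 1)), c y) / ((q : ℝ) - p + 1) * (4 * (2 : ℝ) ^ k)) :=
        mul_le_mul_of_nonneg_left hband hL.le
    _ = ((q : ℝ) - p + 1) / ((q : ℝ) - p + 1) * (16 * (2 : ℝ) ^ k * ∑ y ∈ box z (q + (2 : ℤ) ^ (n + 1)), c y) := by ring
    _ = 16 * (2 : ℝ) ^ k * ∑ y ∈ box z (q + (2 : ℤ) ^ (n + 1)), c y := by rw [div_self hL.ne', one_mul]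
    _ ≤ 16 * (2 : ℝ) ^ k * ∑ y ∈ box z r, c y := mul_le_mul_of_nonneg_left hM (by positivity)
    _ = 4 * (4 / 3 : ℝ) * ((3 * (2 : ℝ) ^ k) * ∑ y ∈ box z r, c y) := by ring

end Summit.QuantumFields.YangMills.Theorems.PoincareLipschitzMaximalGoodShell

end
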